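import Summits.ResolutionOfSingularities.ResolutionOfSingularities.Theorems.EquisingularLiftEquisingularLiftNatTowerConeRound
import Summits.ResolutionOfSingularities.ResolutionOfSingularities.Theorems.EquisingularLiftEquisingularLiftNatConeRoundTransportLoc
import Summits.ResolutionOfSingularities.ResolutionOfSingularities.Theorems.EquisingularLiftEquisingularLiftNatShadowLocalTransport
import Literature.AlgebraicGeometry.Resolution.SpreadModelDataSpread
import Summits.ResolutionOfSingularities.ResolutionOfSingularities.Theorems.EquisingularLiftEquisingularLiftNatTowerRootsDischarge
import HarnessLib

/-!
# [OURS · L1 W4.5(b) · EL♮(3)] HSUB′(ReachTower₄) — THE CONE-WITNESSED ROUND ON `Tower.Inv₃` (LOCALIZED SHADOW TRACE (k-ii-loc)),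
# NEW EXCEPTIONAL SURFACE `E ↦ υ₂⁻¹Z` — twin of res-D-pv-029's `Tower.inv₂_coneRound_new` (…NatTowerConeRound p558403)

res-L1-w45b-stub-4 g8 (res-D-pv-029's retarget list, STATUS 2026-08-27T20:58:53Z; desk NO OBJECTION 21:38:03Z «then the (curve)/(cone) bricks at
Inv₃»). OURS; NOT a statement of any manuscript; AI-written, weaker than expert review. No `sorry`; standard axioms. DEF-FREE.
`--supports stmt-ResolutionOfSingularities-20148 --as helper`.

WHAT. `Tower.inv₃_coneRound_new`: res-D-pv-029's proof VERBATIM (credit: res-D-pv-029 g8) with the three places where the GLOBAL shadow trace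
(k-ii) `𝒦·𝒪_G = 𝓘⟨closure K⟩` entered replaced by their (k-ii-loc) versions (`∃ V ⊇ E, (𝒦·𝒪_G)|_V = 𝓘⟨closure K⟩|_V`):
* centre exactness `(𝓔 ⊔ 𝒦)·𝒪_G = 𝓘⟨Z⟩` GLOBALISES from `V` (`comap_sup_eq_vanishingIdeal_sup_of_loc`: off `E ⊆ V` the summand `𝓔·𝒪_G = 𝓘⟨E⟩` is the unit
  ideal, on `V` the stalks agree);
* `𝒦 ≠ ⊥` from `K ≠ univ`: were `𝒦 = ⊥`, the local trace would force `closure K ⊇ V`, a non-empty open of the irreducible `G`;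
* the new shadow's trace (k-ii-loc) on `υ₂⁻¹V ⊇ υ₂⁻¹Z` by the RESTRICTED T2 `coneRound_shadow_comap_loc` (…NatConeRoundTransportLoc).
Same binders as the `Inv₂` brick (stand-in `hRuled` included — discharged in …NatTowerRootsDischarge style by the `_sec` corollary below), same conclusion
at `Tower.Inv₃`. `Tower.inv₃_coneRound_new_sec`: the stand-in `hRuled` supplied by `DirLift.ruled_coneRound_root_of_dirStepSec` as in p570221.
-/

set_option linter.dupNamespace false -- mandated namespace `Summit.<Summit>.<Problem>` of this single-conjunct summit
set_option linter.overlappingInstances false -- signatures carry `[IsDomain O] [IsDiscreteValuationRing O]`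

noncomputable section

open CategoryTheory CategoryTheory.Limits AlgebraicGeometry TopologicalSpace Topology IsLocalRing
open Literature.AlgebraicGeometry.Resolution
open AlgebraicGeometry.Scheme.IdealSheafData
open Summit.ResolutionOfSingularities.ResolutionOfSingularities.Theses.EquisingularLift.Split
open Summit.ResolutionOfSingularities.ResolutionOfSingularities.Cruxes.EquisingularLift.StrataSplit

namespace Summit.ResolutionOfSingularities.ResolutionOfSingularities.Cruxes.EquisingularLiftNat.Sections

/-- **Centre exactness globalises from the localized shadow trace**: if `𝓔·𝒪_G = 𝓘⟨E⟩` (global), `E ⊆ V` and `(𝒦·𝒪_G)|_V = 𝓘⟨closure K⟩|_V`,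
then `(𝓔 ⊔ 𝒦)·𝒪_G = 𝓘⟨E⟩ ⊔ 𝓘⟨closure K⟩` — off `E` both sides are the unit ideal, on `V` the stalks agree. [OURS · elementary] -/
theorem comap_sup_eq_vanishingIdeal_sup_of_loc {X G : Scheme.{0}} (jG : G ⟶ X) (𝓔 𝒦 : X.IdealSheafData) {E K : Set G}
    (hE : IsClosed E) (he : 𝓔.comap jG = vanishingIdeal (⟨E, hE⟩ : Closeds G)) (V : G.Opens) (hEV : E ⊆ (V : Set G))
    (hk : (𝒦.comap jG).comap V.ι = (vanishingIdeal (⟨closure K, isClosed_closure⟩ : Closeds G)).comap V.ι) :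
    (𝓔 ⊔ 𝒦).comap jG =
      vanishingIdeal (⟨E, hE⟩ : Closeds G) ⊔ vanishingIdeal (⟨closure K, isClosed_closure⟩ : Closeds G) := by
  rw [Scheme.IdealSheafData.comap_sup, he]
  refine ext_of_forall_stalkIdeal_eq fun y => ?_
  rw [stalkIdeal_sup, stalkIdeal_sup]
  by_cases hy : y ∈ (V : Set G)
  · rw [stalkIdeal_eq_of_comap_ι_eq hk hy]
  · have hyE : y ∉ ((vanishingIdeal (⟨E, hE⟩ : Closeds G) : G.IdealSheafData).support : Set G) := by
      rw [Scheme.IdealSheafData.coe_support_vanishingIdeal]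
      exact fun h => hy (hEV h)
    rw [stalkIdeal_eq_top_of_not_mem_support hyE, top_sup_eq, top_sup_eq]

set_option maxHeartbeats 800000 in -- one large refine over a 20-clause invariant
/-- **THE CONE-WITNESSED ROUND on `Tower.Inv₃` (localized shadow trace), new exceptional surface** (see the module docstring).
[cite: GortzWedhorn2020, (13.19) and Prop. 13.91] [cite: Liu2002, Thm. 8.1.19] [OURS · L1 W4.5b] clause (round) of the tower driver toward
`stub_elnat_coneTowerPointResolution`; NOT a statement of the manuscript. -/
theorem Tower.inv₃_coneRound_new (O : Type) [CommRing O] [IsDomain O] [IsDiscreteValuationRing O] (k : Type) [Field k]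
    (θ : O →+* k) (hθ : Function.Surjective θ)
    (P : Scheme.{0}) (q : P ⟶ Spec (.of O)) [IsProper q] (Y : Set P) (hYirr : IsIrreducible Y) (hYcl : IsClosed Y)
    (hPnoeth : IsLocallyNoetherian P) (hPreg : Scheme.IsRegular P)
    (Ch : ∀ X' : Scheme.{0}, (X' ⟶ P) → Set X' → Prop)
    (hChain : ∀ (X' : Scheme.{0}) (σ : X' ⟶ P) (S : Set X'), Ch X' σ S → Chain P Y X' σ S)
    (hStep : ∀ (X' X'' : Scheme.{0}) (σ' : X' ⟶ P) (S' : Set X') (C : X'.IdealSheafData) (τ : X'' ⟶ X'),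
      Ch X' σ' S' → IsBlowup τ C → Scheme.IsRegular C.subscheme → Flat (C.subschemeι ≫ σ' ≫ q) →
      σ' '' (C.support : Set X') ⊆ {x : P | ¬ IsGenericPoint x Y} →
      (C.support : Set X') ∩ (σ' ≫ q) ⁻¹' {IsLocalRing.closedPoint O} ⊆ S' →
      Ch X'' (τ ≫ σ') (closure (τ ⁻¹' (S' \ (C.support : Set X')))))
    (Ruled : Tower.RuledDatum P)
    {F₉ : Scheme.{0}} (Z₉ : Set F₉) (hZ₉ : IsClosed Z₉) {F₁₀ : Scheme.{0}} (υ' : F₁₀ ⟶ F₉)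
    (G G' : Scheme.{0}) (γ : G ⟶ F₁₀) (T E K : Set G) (hE : IsClosed E) (Z : Set G) (hZ : IsClosed Z) (υ₂ : G' ⟶ G)
    (hinv : Tower.Inv₃ O k θ P q Y Ch Ruled F₉ Z₉ hZ₉ F₁₀ υ' G γ T E K)
    (hZET : Z ⊆ E ∩ T) (hZne : Z.Nonempty) (hfull : TowerFull F₉ F₁₀ υ' Z₉ hZ₉ G γ Z hZ) (hcone : ConeWitness G E hE K Z hZ)
    (hυ₂ : IsBlowup υ₂ (vanishingIdeal ⟨Z, hZ⟩))
    -- the assembly's downstairs side facts carried next to `Tower.Inv₂`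
    (hKcl : IsClosed K) (hKE : K ⊆ closure (K \ E)) (hKne : K ≠ Set.univ)
    -- STAND-IN (owner res-L1-w45b-stub-2 / res-type-027): the ruled-surface datum of the new exceptional surface, root = this round
    (hRuled : ∀ (X : Scheme.{0}) (σ : X ⟶ P) (S : Set X) (jG : G ⟶ X) (tG : G ⟶ Spec (.of k)) (𝓔 𝒦 : X.IdealSheafData)
        (X'' : Scheme.{0}) (τ : X'' ⟶ X) (j₂ : G' ⟶ X'') (t₂ : G' ⟶ Spec (.of k)),
        Ch X σ S → IsIntegral X → IsLocallyNoetherian X → Scheme.IsRegular X → IsDominant (σ ≫ q) →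
        IsPullback jG tG (σ ≫ q) (Spec.map (CommRingCat.ofHom θ)) → jG '' T = S →
        (𝓔 ⊔ 𝒦).comap jG = vanishingIdeal ⟨Z, hZ⟩ → Flat ((𝓔 ⊔ 𝒦).subschemeι ≫ σ ≫ q) → Scheme.IsRegular (𝓔 ⊔ 𝒦).subscheme →
        Scheme.IsRegular 𝓔.subscheme → IsBlowup τ (𝓔 ⊔ 𝒦) → IsPullback j₂ t₂ ((τ ≫ σ) ≫ q) (Spec.map (CommRingCat.ofHom θ)) →
        j₂ ≫ τ = υ₂ ≫ jG →
        Ruled F₉ Z₉ hZ₉ F₁₀ υ' G' (υ₂ ≫ γ) (υ₂ ⁻¹' Z) X'' (τ ≫ σ) j₂ ((𝓔 ⊔ 𝒦).comap τ))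
    (K' : Set G') (hK' : K' = ∅ ∨ K' = closure (υ₂ ⁻¹' (K \ Z))) :
    Tower.Inv₃ O k θ P q Y Ch Ruled F₉ Z₉ hZ₉ F₁₀ υ' G' (υ₂ ≫ γ) (closure (υ₂ ⁻¹' (T \ Z))) (υ₂ ⁻¹' Z) K' := by
  classical
  obtain ⟨hυ', hZinf, hGint, hTcl, hTirr, hEcl, hTE₀, X, σ, S, jG, tG, hCh, hXint, hXnoeth, hXreg, hdom, hsq, hTS, hexc⟩ := hinv
  haveI := hGint
  haveI := hXint
  haveI := hXnoeth
  -- the exceptional surface hosts this round, so it is round-ready; the shadow is not forgotten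
  have hZE : Z ⊆ E := fun z hz => (hZET hz).1
  have hZT : Z ⊆ T := fun z hz => (hZET hz).2
  rcases hexc hE with hno | ⟨𝓔, he_i, he_ii, he_iii, he_iv, -, hshadow⟩
  · exact absurd hfull (Tower.not_towerFull_of_noRound υ' Z₉ hZ₉ hZinf G γ E hno Z hZ hZE)
  obtain ⟨hZeq, hwit⟩ := hcone
  rcases hshadow with hK0 | ⟨𝒦, hk_i, ⟨V, hEV, hk_ii⟩, hk_iii, hk_iv, hk_v, hk_vi⟩
  · exfalso
    rw [hK0, closure_empty, Set.inter_empty] at hZeq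
    exact hZne.ne_empty hZeq
  -- properness of the stage; the model square
  obtain ⟨-, -, hσ⟩ := chain_isRegular P Y X σ S (hChain _ _ _ hCh) hPnoeth hPreg
  haveI := hσ
  haveI : IsProper (σ ≫ q) := inferInstance
  haveI : IsClosedImmersion (Spec.map (CommRingCat.ofHom θ)) := IsClosedImmersion.spec_of_surjective _ hθ
  haveI hjci : IsClosedImmersion jG := MorphismProperty.IsStableUnderBaseChange.of_isPullback hsq.flip inferInstance
  have hjsp : ∀ z : G, (σ ≫ q) (jG z) = closedPoint O := fun z => by
    have h1 : jG z ∈ Set.range jG := ⟨z, rfl⟩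
    rw [range_eq_preimage_of_isPullback hsq, range_specMap_of_surjective_of_field θ hθ] at h1
    exact h1
  have hrangej : Set.range jG = (σ ≫ q) ⁻¹' {closedPoint O} := by
    rw [range_eq_preimage_of_isPullback hsq, range_specMap_of_surjective_of_field θ hθ]
  -- the centre `𝒞 := 𝓔 ⊔ 𝒦`: exact trace `𝓘⟨Z⟩` (the cone witness), flat (k-iii), regular, off the generic point
  have hCD : (𝓔 ⊔ 𝒦).comap jG = vanishingIdeal ⟨Z, hZ⟩ := by
    rw [comap_sup_eq_vanishingIdeal_sup_of_loc jG 𝓔 𝒦 hE he_i V hEV hk_ii, hwit]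
  have hZEK : (⟨E ∩ closure K, hE.inter isClosed_closure⟩ : Closeds G) = ⟨Z, hZ⟩ := Closeds.ext hZeq.symm
  have hCreg_pt : ∀ x ∈ ((𝓔 ⊔ 𝒦).support : Set X), (σ ≫ q) x = closedPoint O →
      IsRegularLocalRing (X.presheaf.stalk x ⧸ stalkIdeal (𝓔 ⊔ 𝒦) x) := by
    intro x hx hqx
    obtain ⟨y, rfl⟩ : x ∈ Set.range jG := by rw [hrangej]; exact hqx
    refine hk_iv y hx ?_
    rw [hZEK, hwit]
  haveI : IsProper ((𝓔 ⊔ 𝒦).subschemeι ≫ σ ≫ q) := inferInstance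
  have hCreg : Scheme.IsRegular (𝓔 ⊔ 𝒦).subscheme :=
    Scheme.isRegular_subscheme_of_forall_over_closedPoint (σ ≫ q) (𝓔 ⊔ 𝒦) fun x hx hqx => hCreg_pt x hx hqx
  have hiv : σ '' ((𝓔 ⊔ 𝒦).support : Set X) ⊆ {p : P | ¬ IsGenericPoint p Y} := by
    rintro _ ⟨x, hx, rfl⟩
    exact he_iv ⟨x, Scheme.IdealSheafData.support_antitone le_sup_left hx, rfl⟩
  -- support bookkeeping downstairs
  have hsuppZ : ((vanishingIdeal ⟨Z, hZ⟩ : G.IdealSheafData).support : Set G) = Z := Scheme.IdealSheafData.coe_support_vanishingIdeal _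
  have hDT : ((vanishingIdeal ⟨Z, hZ⟩ : G.IdealSheafData).support : Set G) ⊆ T := by rw [hsuppZ]; exact hZT
  have hTZ : ¬ T ⊆ Z := fun h => hTE₀ (h.trans hZE)
  have hTD : ¬ T ⊆ ((vanishingIdeal ⟨Z, hZ⟩ : G.IdealSheafData).support : Set G) := by rw [hsuppZ]; exact hTZ
  -- blow up the centre and run the model step
  obtain ⟨X₂, τ, hτ⟩ := exists_isBlowup X (𝓔 ⊔ 𝒦)
  obtain ⟨hint₂, hnoeth₂, hreg₂, hdom₂, hF₂, hirr, j₂, t₂, hsq₂, hcomm, hCh₂⟩ :=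
    modelStep_chain O k θ hθ P q Y hYirr hYcl Ch hChain hStep X σ S hCh hXreg hdom G jG tG hsq T hTS (𝓔 ⊔ 𝒦)
      (vanishingIdeal ⟨Z, hZ⟩) hCD hCreg hk_iii hiv hDT hTD X₂ τ hτ G' υ₂ hυ₂
  rw [hsuppZ] at hirr hCh₂
  haveI := hint₂
  haveI := hnoeth₂
  haveI := hF₂
  haveI : IsProper τ := hτ.isProper
  have hcart : IsPullback j₂ υ₂ τ jG := isPullback_of_model_squares θ hθ (σ ≫ q) τ jG tG hsq j₂ t₂
    (by simpa only [Category.assoc] using hsq₂) υ₂ hcomm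
  -- a point of `G'` off the exceptional surface, `T' ⊄ E'`, the centre is non-zero
  obtain ⟨t, htT, htE⟩ := Set.not_subset.mp hTE₀
  have htZ : t ∉ Z := fun h => htE (hZE h)
  obtain ⟨t', ht'⟩ := hυ₂.exists_preimage_of_not_mem_support (z := t) (by rw [hsuppZ]; exact htZ)
  have hTE : ¬ closure (υ₂ ⁻¹' (T \ Z)) ⊆ υ₂ ⁻¹' Z := by
    intro h
    have h1 : t' ∈ closure (υ₂ ⁻¹' (T \ Z)) := subset_closure (show υ₂ t' ∈ T \ Z by rw [ht']; exact ⟨htT, htZ⟩)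
    have h2 : υ₂ t' ∈ Z := h h1
    rw [ht'] at h2
    exact htZ h2
  have hCne : 𝓔 ⊔ 𝒦 ≠ ⊥ := by
    rintro hbot
    obtain ⟨u, hu, hKu⟩ := hτ.isEffectiveCartier.exists_stalkIdeal_eq_span (j₂ t')
    rw [hbot, Scheme.IdealSheafData.comap_bot, stalkIdeal_bot, eq_comm, Ideal.span_singleton_eq_bot] at hKu
    rw [hKu] at hu
    exact zero_notMem_nonZeroDivisors hu
  -- quasi-regular frames of the regular centre at the points over `Z`
  have hqr : ∀ z ∈ ((⟨Z, hZ⟩ : Closeds G) : Set G), ∃ (n : ℕ) (c : Fin n → X.presheaf.stalk (jG z)),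
      Ideal.span (Set.range c) = stalkIdeal (𝓔 ⊔ 𝒦) (jG z) ∧ IsQuasiRegular c := by
    intro z hz
    have hzC : jG z ∈ ((𝓔 ⊔ 𝒦).support : Set X) := by
      have h1 : z ∈ (((𝓔 ⊔ 𝒦).comap jG).support : Set G) := by rw [hCD, hsuppZ]; exact hz
      rw [Scheme.IdealSheafData.support_comap] at h1
      exact h1
    haveI : IsRegularLocalRing (X.presheaf.stalk (jG z)) := hXreg (jG z)
    haveI : IsRegularLocalRing (X.presheaf.stalk (jG z) ⧸ stalkIdeal (𝓔 ⊔ 𝒦) (jG z)) := hCreg_pt _ hzC (hjsp z)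
    obtain ⟨n, c, -, hc, hq, -⟩ := exists_isQuasiRegular_span_eq_of_isRegularLocalRing_quotient
      (J := stalkIdeal (𝓔 ⊔ 𝒦) (jG z)) ((mem_support_iff_stalkIdeal_le _ _).mp hzC) (stalkIdeal (𝓔 ⊔ 𝒦) (jG z) : Set _)
      (Ideal.span_eq _)
    exact ⟨n, c, hc, hq⟩
  -- (e-i)…(e-iv) for the new exceptional surface `𝓔' := 𝒞·𝒪_{X₂}`
  have he1 : ((𝓔 ⊔ 𝒦).comap τ).comap j₂ = vanishingIdeal ⟨υ₂ ⁻¹' Z, hZ.preimage υ₂.continuous⟩ :=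
    comap_comap_eq_vanishingIdeal_preimage_of_model O k θ hθ (σ ≫ q) jG tG hsq (𝓔 ⊔ 𝒦) τ hτ j₂ t₂
      (by simpa only [Category.assoc] using hsq₂) υ₂ hcomm ⟨Z, hZ⟩ hCD hqr
  have he2 : ∀ z : X₂, (stalkIdeal ((𝓔 ⊔ 𝒦).comap τ) z).IsPrincipal := fun z => by
    obtain ⟨u, -, hu⟩ := hτ.isEffectiveCartier.exists_stalkIdeal_eq_span z
    exact ⟨⟨u, by rw [hu, Ideal.submodule_span_eq]⟩⟩
  have he3 : Scheme.IsRegular ((𝓔 ⊔ 𝒦).comap τ).subscheme := hτ.isRegular_subscheme_comap hXreg hCreg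
  have he4 : (τ ≫ σ) '' (((𝓔 ⊔ 𝒦).comap τ).support : Set X₂) ⊆ {p : P | ¬ IsGenericPoint p Y} := by
    rintro _ ⟨z, hz, rfl⟩
    rw [Scheme.IdealSheafData.support_comap] at hz
    exact hiv ⟨τ z, hz, rfl⟩
  -- the transported cone `𝒦' := St_𝒞 𝒦`: (k-i)…(k-vi)
  have hk1 : ∀ z : X₂, (stalkIdeal (strictTransformIdeal τ (𝓔 ⊔ 𝒦) 𝒦) z).IsPrincipal := fun z =>
    isPrincipal_stalkIdeal_strictTransformIdeal hXreg hCreg hτ hCne 𝒦 hk_i z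
  have hKc : K = closure K := hKcl.closure_eq.symm
  have hk2 : ((strictTransformIdeal τ (𝓔 ⊔ 𝒦) 𝒦).comap j₂).comap (υ₂ ⁻¹ᵁ V).ι =
      (vanishingIdeal (⟨closure (closure (υ₂ ⁻¹' (K \ Z))), isClosed_closure⟩ : Closeds G')).comap (υ₂ ⁻¹ᵁ V).ι := by
    have hdense : ((⟨closure K, isClosed_closure⟩ : Closeds G) : Set G) ∩ (V : Set G) ⊆
        closure (((⟨closure K, isClosed_closure⟩ : Closeds G) : Set G) \ (⟨Z, hZ⟩ : Closeds G)) := by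
      intro x hx
      have hx1 : x ∈ K := by rw [hKc]; exact hx.1
      have hsub : K ⊆ closure (K \ Z) := hKE.trans (closure_mono fun x hx => ⟨hx.1, fun hxZ => hx.2 (hZE hxZ)⟩)
      change x ∈ closure (closure K \ Z)
      rw [← hKc]
      exact hsub hx1
    have h := coneRound_shadow_comap_loc 𝓔 𝒦 hk_v hτ hcart ⟨closure K, isClosed_closure⟩ ⟨Z, hZ⟩ V hk_ii hυ₂ hdense
    rw [h]
    congr 2
    refine Closeds.ext ?_
    change closure (υ₂ ⁻¹' (closure K \ Z)) = closure (closure (υ₂ ⁻¹' (K \ Z)))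
    rw [closure_closure, ← hKc]
  have hk3 : Flat ((((𝓔 ⊔ 𝒦).comap τ) ⊔ strictTransformIdeal τ (𝓔 ⊔ 𝒦) 𝒦).subschemeι ≫ (τ ≫ σ) ≫ q) := by
    have h := coneRound_flat 𝓔 𝒦 hk_v hτ (σ ≫ q) hk_iii
    simpa only [Category.assoc] using h
  have hk4reg : Scheme.IsRegular (((𝓔 ⊔ 𝒦).comap τ) ⊔ strictTransformIdeal τ (𝓔 ⊔ 𝒦) 𝒦).subscheme :=
    coneRound_isRegular 𝓔 𝒦 hk_v hτ hCreg
  have hk4 : ∀ (E' : Set G') (hE' : IsClosed E') (K'' : Set G') (y : G'),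
      j₂ y ∈ ((((𝓔 ⊔ 𝒦).comap τ) ⊔ strictTransformIdeal τ (𝓔 ⊔ 𝒦) 𝒦).support : Set X₂) →
      stalkIdeal (vanishingIdeal (⟨E', hE'⟩ : Closeds G') ⊔
        vanishingIdeal (⟨closure K'', isClosed_closure⟩ : Closeds G')) y =
      stalkIdeal (vanishingIdeal (⟨E' ∩ closure K'', hE'.inter isClosed_closure⟩ : Closeds G')) y →
      IsRegularLocalRing (X₂.presheaf.stalk (j₂ y) ⧸
        stalkIdeal (((𝓔 ⊔ 𝒦).comap τ) ⊔ strictTransformIdeal τ (𝓔 ⊔ 𝒦) 𝒦) (j₂ y)) := by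
    intro E' hE' K'' y hy _
    obtain ⟨s, hs⟩ : j₂ y ∈ Set.range (((𝓔 ⊔ 𝒦).comap τ) ⊔ strictTransformIdeal τ (𝓔 ⊔ 𝒦) 𝒦).subschemeι := by
      rw [Scheme.IdealSheafData.range_subschemeι]; exact hy
    have h := (isRegularLocalRing_stalk_subscheme_iff _ s).mp (hk4reg s)
    rw [show (((𝓔 ⊔ 𝒦).comap τ) ⊔ strictTransformIdeal τ (𝓔 ⊔ 𝒦) 𝒦).subschemeι.base s = j₂ y from hs] at h
    exact h
  have hk5 : IsEffectiveCartier (((𝓔 ⊔ 𝒦).comap τ).comap (strictTransformIdeal τ (𝓔 ⊔ 𝒦) 𝒦).subschemeι) :=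
    isEffectiveCartier_cone_next 𝓔 𝒦 hτ
  have hKne' : 𝒦 ≠ ⊥ := by
    intro hK0
    -- on `V` the local trace would make `closure K ⊇ V`, a non-empty open of the irreducible `G`
    have hVK : (V : Set G) ⊆ closure K := fun x hx =>
      (mem_support_iff_mem_closure_of_comap_ι_eq jG 𝒦 K V hk_ii hx).mp (by rw [hK0, Scheme.IdealSheafData.support_bot]; trivial)
    obtain ⟨z, hz⟩ := hZne
    have hVne : (V : Set G).Nonempty := ⟨z, hEV (hZE hz)⟩
    have hdenseV : Dense (V : Set G) := V.2.dense hVne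
    apply hKne
    rw [hKc]
    exact Set.eq_univ_of_univ_subset ((hdenseV.closure_eq ▸ closure_minimal hVK isClosed_closure :
      (Set.univ : Set G) ⊆ closure K))
  have hStne : strictTransformIdeal τ (𝓔 ⊔ 𝒦) 𝒦 ≠ ⊥ := by
    intro h0
    have hle : 𝒦.comap τ ≤ strictTransformIdeal τ (𝓔 ⊔ 𝒦) 𝒦 := comap_le_strictTransformIdeal τ (𝓔 ⊔ 𝒦) 𝒦
    rw [h0, le_bot_iff] at hle
    apply stalkIdeal_ne_bot_of_ne_bot hKne' (τ (j₂ t'))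
    have h3 : stalkIdeal (𝒦.comap τ) (j₂ t') = ⊥ := by rw [hle, stalkIdeal_bot]
    rw [stalkIdeal_comap_eq_map_stalkMap] at h3
    exact (Ideal.map_eq_bot_iff_of_injective (hτ.stalkMap_injective (j₂ t'))).mp h3
  have hk6 : IsEffectiveCartier ((strictTransformIdeal τ (𝓔 ⊔ 𝒦) 𝒦).comap ((𝓔 ⊔ 𝒦).comap τ).subschemeι) :=
    isEffectiveCartier_comap_subschemeι_swap ((𝓔 ⊔ 𝒦).comap τ) (strictTransformIdeal τ (𝓔 ⊔ 𝒦) 𝒦) he2 hk1 he3 hStne hk5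
  -- assemble
  refine ⟨hυ', hZinf, hF₂, isClosed_closure, hirr, hZ.preimage υ₂.continuous, hTE, X₂, τ ≫ σ, _, j₂, t₂, hCh₂, hint₂, hnoeth₂,
    hreg₂, hdom₂, hsq₂, rfl, fun hE' => Or.inr ⟨(𝓔 ⊔ 𝒦).comap τ, he1, he2, he3, he4, ?_, ?_⟩⟩
  · exact hRuled X σ S jG tG 𝓔 𝒦 X₂ τ j₂ t₂ hCh hXint hXnoeth hXreg hdom hsq hTS hCD hk_iii hCreg he_iii hτ hsq₂ hcomm
  · rcases hK' with hK' | hK'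
    · exact Or.inl hK'
    · subst hK'
      exact Or.inr ⟨_, hk1, ⟨υ₂ ⁻¹ᵁ V, Set.preimage_mono (hZE.trans hEV), hk2⟩, hk3, hk4 _ _ _, hk5, hk6⟩

/-! ## At `Ruled := DirLift.Ruled`: the root stand-in discharged (…NatTowerRootsDischarge pattern) -/

set_option maxHeartbeats 400000 in -- one application of a 40-binder brick with a 25-binder lambda
/-- **THE CONE-WITNESSED ROUND on `Tower.Inv₃` at `Ruled := DirLift.Ruled`, new exceptional surface, WITHOUT the root stand-in S2** (see the
module docstring): `Tower.inv₃_coneRound_new` with `hRuled` supplied by `DirLift.ruled_coneRound_root_of_dirStepSec` — inputs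
(a) `hυ₂` and (e) `hsec` from the round, (b) from the chain (`image_support_subset_not_isGenericPoint_of_chain_of_subset`), (c) the OWNED stand-in
`hFrame` (stub-3 currency), (d) the residue binder `hTj : RationalCarrierLift O k θ P q` (o6). `TowerFull` is derived from `hsec`. [cite: GortzWedhorn2020, (13.19) and Prop. 13.91]
[cite: Liu2002, Thm. 8.1.19] [OURS · L1 W4.5b · pure logic over `Tower.inv₃_coneRound_new` / p567376 / p568471] clause (round, cone) of the TOWER₄ driver at `Inv₃`
toward `stub_elnat_coneTowerPointResolution` (stmt-ResolutionOfSingularities-20148 / -20038); NOT a statement of the manuscript. -/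
theorem Tower.inv₃_coneRound_new_sec (O : Type) [CommRing O] [IsDomain O] [IsDiscreteValuationRing O] (k : Type) [Field k]
    (θ : O →+* k) (hθ : Function.Surjective θ)
    (P : Scheme.{0}) (q : P ⟶ Spec (.of O)) [IsProper q] (Y : Set P) (hYsp : Y ⊆ q ⁻¹' {closedPoint O})
    (hYirr : IsIrreducible Y) (hYcl : IsClosed Y) (hPnoeth : IsLocallyNoetherian P) (hPreg : Scheme.IsRegular P)
    (Ch : ∀ X' : Scheme.{0}, (X' ⟶ P) → Set X' → Prop)
    (hChain : ∀ (X' : Scheme.{0}) (σ : X' ⟶ P) (S : Set X'), Ch X' σ S → Chain P Y X' σ S)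
    (hStep : ∀ (X' X'' : Scheme.{0}) (σ' : X' ⟶ P) (S' : Set X') (C : X'.IdealSheafData) (τ : X'' ⟶ X'),
      Ch X' σ' S' → IsBlowup τ C → Scheme.IsRegular C.subscheme → Flat (C.subschemeι ≫ σ' ≫ q) →
      σ' '' (C.support : Set X') ⊆ {x : P | ¬ IsGenericPoint x Y} →
      (C.support : Set X') ∩ (σ' ≫ q) ⁻¹' {IsLocalRing.closedPoint O} ⊆ S' →
      Ch X'' (τ ≫ σ') (closure (τ ⁻¹' (S' \ (C.support : Set X')))))
    {F₉ : Scheme.{0}} (Z₉ : Set F₉) (hZ₉ : IsClosed Z₉) {F₁₀ : Scheme.{0}} (υ' : F₁₀ ⟶ F₉)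
    (G G' : Scheme.{0}) (γ : G ⟶ F₁₀) (T E K : Set G) (hE : IsClosed E) (Z : Set G) (hZ : IsClosed Z) (υ₂ : G' ⟶ G)
    (hinv : Tower.Inv₃ O k θ P q Y Ch (DirLift.Ruled O k θ P q Y) F₉ Z₉ hZ₉ F₁₀ υ' G γ T E K)
    (hZET : Z ⊆ E ∩ T) (hZne : Z.Nonempty) (hsec : DirStepSec F₉ F₁₀ υ' Z₉ hZ₉ G γ Z hZ) (hcone : ConeWitness G E hE K Z hZ)
    (hυ₂ : IsBlowup υ₂ (vanishingIdeal ⟨Z, hZ⟩))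
    -- the assembly's downstairs side facts carried next to `Tower.Inv₂`
    (hKcl : IsClosed K) (hKE : K ⊆ closure (K \ E)) (hKne : K ≠ Set.univ)
    -- STAND-IN (c), owner res-L1-w45b-stub-3 (p564791 + (β) T-DIM-CENTRE): quasi-regular 2-frames of a regular `O`-flat centre with trace `𝓘⟨Z⟩`
    (hFrame : ∀ (X : Scheme.{0}) (σ : X ⟶ P) (S : Set X) (jG : G ⟶ X) (tG : G ⟶ Spec (.of k)) (𝒞 : X.IdealSheafData),
      Ch X σ S → IsIntegral X → IsLocallyNoetherian X → Scheme.IsRegular X → IsDominant (σ ≫ q) →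
      IsPullback jG tG (σ ≫ q) (Spec.map (CommRingCat.ofHom θ)) → jG '' T = S →
      𝒞.comap jG = vanishingIdeal ⟨Z, hZ⟩ → Flat (𝒞.subschemeι ≫ σ ≫ q) → Scheme.IsRegular 𝒞.subscheme →
      ∀ x ∈ 𝒞.support, ∃ c : Fin 2 → X.presheaf.stalk x, Ideal.span (Set.range c) = stalkIdeal 𝒞 x ∧ IsQuasiRegular c)
    -- RESIDUE (d) = (T-j), owner res-L1-type-o6 (…NatRationalCarrierLift): conditional upstairs rationality of regular `O`-flat centres
    (hTj : RationalCarrierLift O k θ P q)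
    (K' : Set G') (hK' : K' = ∅ ∨ K' = closure (υ₂ ⁻¹' (K \ Z))) :
    Tower.Inv₃ O k θ P q Y Ch (DirLift.Ruled O k θ P q Y) F₉ Z₉ hZ₉ F₁₀ υ' G' (υ₂ ≫ γ) (closure (υ₂ ⁻¹' (T \ Z)))
      (υ₂ ⁻¹' Z) K' := by
  have hZE : Z ⊆ E := fun z hz => (hZET hz).1
  have hTE : ¬ T ⊆ E := hinv.2.2.2.2.2.2.1
  exact Tower.inv₃_coneRound_new O k θ hθ P q Y hYirr hYcl hPnoeth hPreg Ch hChain hStep (DirLift.Ruled O k θ P q Y) Z₉ hZ₉ υ' G G'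
    γ T E K hE Z hZ υ₂ hinv hZET hZne (towerFull_of_dirStepSec hsec) hcone hυ₂ hKcl hKE hKne
    (fun X σ S jG tG 𝓔 𝒦 X'' τ j₂ t₂ hCh hXint hXnoeth hXreg hdom hsq hTS hCD hCflat hCreg _ hτ hsq₂ hcomm => by
      haveI := hXint
      haveI := hXnoeth
      exact DirLift.ruled_coneRound_root_of_dirStepSec G G' γ T Z hZ υ₂ X σ S jG tG 𝓔 𝒦 X'' τ j₂ t₂ hXreg hsq hTS hCD hCflat
        hCreg hτ hsq₂ hcomm hυ₂ hsec
        (image_support_subset_not_isGenericPoint_of_chain_of_subset θ hθ q Y hYsp σ S (hChain _ _ _ hCh) jG tG hsq T hTS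
          (𝓔 ⊔ 𝒦) Z hZ hCD E hZE hTE)
        (hFrame X σ S jG tG (𝓔 ⊔ 𝒦) hCh hXint hXnoeth hXreg hdom hsq hTS hCD hCflat hCreg)
        (fun h₉ => by
          haveI : IsProper σ := (chain_isRegular P Y X σ S (hChain _ _ _ hCh) hPnoeth hPreg).2.2
          exact hTj.hCrat_of_isProper σ (𝓔 ⊔ 𝒦) hsq hCD hCflat hCreg (rationalCarrier_of_dirStepSec hsec h₉)))
    K' hK'

end Summit.ResolutionOfSingularities.ResolutionOfSingularities.Cruxes.EquisingularLiftNat.Sections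

end
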